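import Literature.Probability.Percolation.TruncatedSusceptibility
import Literature.Probability.Percolation.PercolationProofs
import Mathlib.Analysis.SpecialFunctions.Pow.Real
import Mathlib.Analysis.MeanInequalities
import HarnessLib

/-!
# Rooted mean bound `E|K_u ∩ Λ| ≤ C(θ₀) A M^{1-θ}` (crux stmt-CriticalPhenomena-5786,
# line bk-hyperscaling-tail-transfer, stub `stub_rootedMeanBound`)

Crux `PercShatteringRace.FreeSusceptibilityPowerSaving` (namespace
`Summit.CriticalPhenomena.PercolationContinuityZ3.Theses`; item stmt-CriticalPhenomena-5786),
line `bk-hyperscaling-tail-transfer`, stub `stub_rootedMeanBound`: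
the "rooted mean" half of Hutchcroft's BK hyperscaling inequality (PTRF 181 (2021),
arXiv:2008.11197, Cor. 2.6 and the proof of Thm. 2.1/2.5, p. 14).  For a product Bernoulli
measure `prodBernoulli w` on the pairs of a countable vertex set `V`, a finite `Λ`, a root
`u ∈ Λ` and `M = typicalMax (prodBernoulli w) Λ` (the typical value of `|K_max(Λ)|`): a volume
tail AT THE ROOT, `P(n ≤ |K_u ∩ Λ|) ≤ A n^{-θ}` for `n ≥ 1` (`0 ≤ θ ≤ θ₀ < 1`, `A ≥ 1`), forces
`Σ_{v ∈ Λ} P(u ↔ v) = E|K_u ∩ Λ| ≤ C(θ₀) A M^{1-θ}` with `C(θ₀) = 40 / (3 (1 - θ₀))`.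

Proof: `Σ_{v ∈ Λ} P(u ↔ v) = E|K_u ∩ Λ| = Σ_{n < |Λ|} P(n + 1 ≤ |K_u ∩ Λ|)` (layer cake,
`integral_clusterCapIn_eq_sum_real_ge`); the head `n < 10 M` of this sum carries three quarters
of it (`sum_real_clusterCapIn_ge_head_ge`, rooted universal tightness); on the head the tail
hypothesis and the elementary `Σ_{m=1}^{N} m^{-θ} ≤ N^{1-θ}/(1-θ)` give
`A (10M)^{1-θ}/(1-θ) ≤ 10 A M^{1-θ}/(1-θ₀)`.
-/

noncomputable section

namespace Summit.CriticalPhenomena.PercolationContinuityZ3.Theorems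

open MeasureTheory Finset Literature.Probability.Percolation Literature.Probability.LatticeModels

namespace StubRootedMeanBound

/-- Concavity step `(1 - γ) (x + 1)^{-γ} ≤ (x + 1)^{1-γ} - x^{1-γ}` for `x ≥ 0`, `0 ≤ γ < 1`
(weighted AM–GM `x^{1-γ} (x+1)^γ ≤ (1-γ) x + γ (x+1) = x + γ`). [folklore] -/
-- adapted from `Literature.NumberTheory.LFunctions.VanDerCorputDerivTests` (`rpow_neg_le_sub_rpow`,
-- there with `0 < γ`).
theorem rpow_neg_le_sub_rpow {x γ : ℝ} (hx : 0 ≤ x) (hγ : 0 ≤ γ) (hγ1 : γ < 1) :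
    (1 - γ) * (x + 1) ^ (-γ) ≤ (x + 1) ^ (1 - γ) - x ^ (1 - γ) := by
  have hx1 : 0 < x + 1 := by linarith
  have hamgm : x ^ (1 - γ) * (x + 1) ^ γ ≤ (1 - γ) * x + γ * (x + 1) :=
    Real.geom_mean_le_arith_mean2_weighted (by linarith) hγ hx hx1.le (by ring)
  have hpow : 0 < (x + 1) ^ (-γ) := Real.rpow_pos_of_pos hx1 _
  have h1 : x ^ (1 - γ) = x ^ (1 - γ) * (x + 1) ^ γ * (x + 1) ^ (-γ) := by
    rw [mul_assoc, ← Real.rpow_add hx1, add_neg_cancel, Real.rpow_zero, mul_one]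
  have h2 : (x + 1) ^ (1 - γ) = (x + 1) * (x + 1) ^ (-γ) := by
    rw [sub_eq_add_neg, Real.rpow_add hx1, Real.rpow_one]
  rw [h1, h2]
  have h3 : x ^ (1 - γ) * (x + 1) ^ γ * (x + 1) ^ (-γ) ≤
      ((1 - γ) * x + γ * (x + 1)) * (x + 1) ^ (-γ) :=
    mul_le_mul_of_nonneg_right hamgm hpow.le
  nlinarith [h3, hpow]

/-- `Σ_{i < n} (i + 1)^{-γ} ≤ n^{1-γ}/(1-γ)` for `0 ≤ γ < 1` (telescoping the concavity step).
[folklore] -/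
theorem sum_range_rpow_neg_le (n : ℕ) {γ : ℝ} (hγ : 0 ≤ γ) (hγ1 : γ < 1) :
    ∑ i ∈ Finset.range n, ((i : ℝ) + 1) ^ (-γ) ≤ (n : ℝ) ^ (1 - γ) / (1 - γ) := by
  have hγ' : 0 < 1 - γ := by linarith
  rw [le_div_iff₀ hγ', Finset.sum_mul]
  have key : ∀ i ∈ Finset.range n,
      ((i : ℝ) + 1) ^ (-γ) * (1 - γ) ≤ ((i : ℝ) + 1) ^ (1 - γ) - (i : ℝ) ^ (1 - γ) := by
    intro i _
    rw [mul_comm]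
    exact rpow_neg_le_sub_rpow (Nat.cast_nonneg i) hγ hγ1
  refine (Finset.sum_le_sum key).trans ?_
  have htel := Finset.sum_range_sub (fun i : ℕ => (i : ℝ) ^ (1 - γ)) n
  simp only [Nat.cast_add, Nat.cast_one, Nat.cast_zero] at htel
  rw [htel, Real.zero_rpow hγ'.ne', sub_zero]

variable {V : Type*}

/-- `|K_u ∩ Λ| = Σ_{v ∈ Λ} 𝟙{u ↔ v}` pointwise. [folklore] -/
theorem clusterCapIn_real_eq_sum_indicator_openConn (Λ : Finset V) (ω : BondConfig V) (u : V) :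
    (clusterCapIn Λ ω u : ℝ) = ∑ v ∈ Λ, (openConn u v).indicator (fun _ => (1 : ℝ)) ω := by
  classical
  rw [clusterCapIn_eq, Finset.card_filter]
  push_cast
  refine Finset.sum_congr rfl fun v _ => ?_
  by_cases h : (openGraph ω).Reachable u v
  · rw [if_pos h, Set.indicator_of_mem (show ω ∈ openConn u v from h)]
  · rw [if_neg h, Set.indicator_of_notMem (show ω ∉ openConn u v from h)]

/-- **`Σ_{v ∈ Λ} P(u ↔ v) = E|K_u ∩ Λ|`** (linearity; `V` countable so that `{u ↔ v}` is
measurable). [cite: Hutchcroft2021, §2.1 (p. 11)] -/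
theorem sum_real_openConn_eq_integral [Countable V] (μ : Measure (BondConfig V))
    [IsFiniteMeasure μ] (Λ : Finset V) (u : V) :
    ∑ v ∈ Λ, μ.real (openConn u v) = ∫ ω, (clusterCapIn Λ ω u : ℝ) ∂μ := by
  have hmeas : ∀ v : V, MeasurableSet (openConn u v : Set (BondConfig V)) :=
    fun v => measurableSet_openConn_holds u v
  calc ∑ v ∈ Λ, μ.real (openConn u v)
      = ∑ v ∈ Λ, ∫ ω, (openConn u v).indicator (fun _ => (1 : ℝ)) ω ∂μ := by
        refine Finset.sum_congr rfl fun v _ => ?_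
        rw [integral_indicator_const _ (hmeas v), smul_eq_mul, mul_one]
    _ = ∫ ω, ∑ v ∈ Λ, (openConn u v).indicator (fun _ => (1 : ℝ)) ω ∂μ :=
        (integral_finsetSum _ fun v _ => (integrable_const (1 : ℝ)).indicator (hmeas v)).symm
    _ = ∫ ω, (clusterCapIn Λ ω u : ℝ) ∂μ :=
        integral_congr_ae (ae_of_all _ fun ω =>
          (clusterCapIn_real_eq_sum_indicator_openConn Λ ω u).symm)

end StubRootedMeanBound

open StubRootedMeanBound in
/-- **Rooted mean bound (Hutchcroft 2021, Cor. 2.6 + layer cake).**  For every `θ₀ < 1` there is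
`C = 40 / (3 (1 - θ₀)) > 0` such that for every countable `V`, weight `w`, finite `Λ`,
`0 ≤ θ ≤ θ₀`, `A ≥ 1` and every root `u ∈ Λ`: if `P(n ≤ |K_u ∩ Λ|) ≤ A n^{-θ}` for all
integers `n ≥ 1` (tail at the root `u` only), then `Σ_{v ∈ Λ} P(u ↔ v) ≤ C · A · M^{1-θ}` with
`M = typicalMax (prodBernoulli w) Λ`.  Proof:
`Σ_v P(u ↔ v) = E|K_u ∩ Λ| = Σ_{n<|Λ|} P(n+1 ≤ |K_u ∩ Λ|)`; the head `n < 10M` carries `3/4`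
of the sum (`sum_real_clusterCapIn_ge_head_ge`); on the head the
tail hypothesis gives `A Σ_{m ≤ 10M} m^{-θ} ≤ A (10M)^{1-θ}/(1-θ) ≤ 10 A M^{1-θ}/(1-θ₀)`.
[cite: Hutchcroft2021, Cor 2.6 and proof of Thm 2.1/2.5 (p. 14)] -/
theorem stub_rootedMeanBound :
    ∀ θ₀ : ℝ, θ₀ < 1 → ∃ C : ℝ, 0 < C ∧
      ∀ (V : Type) [Countable V] (w : Sym2 V → unitInterval) (Λ : Finset V) (θ A : ℝ),
      0 ≤ θ → θ ≤ θ₀ → 1 ≤ A → ∀ u ∈ Λ,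
      (∀ n : ℕ, 1 ≤ n →
        (prodBernoulli w).real {ω | n ≤ clusterCapIn Λ ω u} ≤ A * (n : ℝ) ^ (-θ)) →
      ∑ v ∈ Λ, (prodBernoulli w).real (openConn u v)
        ≤ C * A * (typicalMax (prodBernoulli w) Λ : ℝ) ^ (1 - θ) := by
  intro θ₀ hθ₀
  have h1θ₀ : 0 < 1 - θ₀ := by linarith
  refine ⟨40 / (3 * (1 - θ₀)), div_pos (by norm_num) (by linarith), ?_⟩
  intro V _ w Λ θ A hθ hθθ₀ hA u hu htail
  classical
  have hΛ : Λ.Nonempty := ⟨u, hu⟩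
  set μ := prodBernoulli w with hμ
  set M := typicalMax μ Λ with hM
  have hM2 : 2 ≤ M := two_le_typicalMax μ hΛ
  have hMpos : (0 : ℝ) < M := by exact_mod_cast (show 0 < M by omega)
  have h1θ : 0 < 1 - θ := by linarith
  have hA0 : 0 ≤ A := by linarith
  -- (i) + (ii): `Σ_v P(u ↔ v) = E|K_u ∩ Λ| = Σ_{n < |Λ|} P(n + 1 ≤ |K_u ∩ Λ|)`
  have hS : ∑ v ∈ Λ, μ.real (openConn u v) =
      ∑ n ∈ range Λ.card, μ.real {ω | n + 1 ≤ clusterCapIn Λ ω u} := by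
    rw [sum_real_openConn_eq_integral μ Λ u, integral_clusterCapIn_eq_sum_real_ge μ Λ u]
  -- (iii): the head carries three quarters
  have hhead : (3 / 4) * ∑ n ∈ range Λ.card, μ.real {ω | n + 1 ≤ clusterCapIn Λ ω u} ≤
      ∑ n ∈ range (min (10 * M) Λ.card), μ.real {ω | n + 1 ≤ clusterCapIn Λ ω u} :=
    sum_real_clusterCapIn_ge_head_ge w hΛ u
  -- (iv): the tail hypothesis on the head
  have hterm : ∀ n : ℕ, μ.real {ω | n + 1 ≤ clusterCapIn Λ ω u} ≤ A * ((n : ℝ) + 1) ^ (-θ) := by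
    intro n
    have h := htail (n + 1) (Nat.le_add_left 1 n)
    push_cast at h
    exact h
  have hhead2 : ∑ n ∈ range (min (10 * M) Λ.card), μ.real {ω | n + 1 ≤ clusterCapIn Λ ω u} ≤
      A * (((10 * M : ℕ) : ℝ) ^ (1 - θ) / (1 - θ)) :=
    calc ∑ n ∈ range (min (10 * M) Λ.card), μ.real {ω | n + 1 ≤ clusterCapIn Λ ω u}
        ≤ ∑ n ∈ range (10 * M), μ.real {ω | n + 1 ≤ clusterCapIn Λ ω u} :=
          sum_le_sum_of_subset_of_nonneg (range_subset_range.2 (min_le_left _ _))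
            fun _ _ _ => measureReal_nonneg
      _ ≤ ∑ n ∈ range (10 * M), A * ((n : ℝ) + 1) ^ (-θ) := sum_le_sum fun n _ => hterm n
      _ = A * ∑ n ∈ range (10 * M), ((n : ℝ) + 1) ^ (-θ) := by rw [mul_sum]
      _ ≤ A * (((10 * M : ℕ) : ℝ) ^ (1 - θ) / (1 - θ)) :=
          mul_le_mul_of_nonneg_left (sum_range_rpow_neg_le _ hθ (by linarith)) hA0
  -- (v): `(10 M)^{1-θ} ≤ 10 M^{1-θ}` and `1/(1-θ) ≤ 1/(1-θ₀)`
  have hMθ : 0 ≤ (M : ℝ) ^ (1 - θ) := Real.rpow_nonneg hMpos.le _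
  have h10 : ((10 * M : ℕ) : ℝ) ^ (1 - θ) ≤ 10 * (M : ℝ) ^ (1 - θ) := by
    push_cast
    rw [Real.mul_rpow (by norm_num) hMpos.le]
    refine mul_le_mul_of_nonneg_right ?_ hMθ
    calc (10 : ℝ) ^ (1 - θ) ≤ 10 ^ (1 : ℝ) :=
          Real.rpow_le_rpow_of_exponent_le (by norm_num) (by linarith)
      _ = 10 := Real.rpow_one _
  have hinv : 1 / (1 - θ) ≤ 1 / (1 - θ₀) := one_div_le_one_div_of_le h1θ₀ (by linarith)
  have hdiv : ((10 * M : ℕ) : ℝ) ^ (1 - θ) / (1 - θ) ≤ 10 * (M : ℝ) ^ (1 - θ) / (1 - θ) :=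
    div_le_div_of_nonneg_right h10 h1θ.le
  rw [hS]
  calc ∑ n ∈ range Λ.card, μ.real {ω | n + 1 ≤ clusterCapIn Λ ω u}
      ≤ (4 / 3) * (A * (((10 * M : ℕ) : ℝ) ^ (1 - θ) / (1 - θ))) := by linarith [hhead, hhead2]
    _ ≤ (4 / 3) * (A * (10 * (M : ℝ) ^ (1 - θ) / (1 - θ))) :=
        mul_le_mul_of_nonneg_left (mul_le_mul_of_nonneg_left hdiv hA0) (by norm_num)
    _ = (40 / 3) * A * (M : ℝ) ^ (1 - θ) * (1 / (1 - θ)) := by ring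
    _ ≤ (40 / 3) * A * (M : ℝ) ^ (1 - θ) * (1 / (1 - θ₀)) :=
        mul_le_mul_of_nonneg_left hinv (mul_nonneg (mul_nonneg (by norm_num) hA0) hMθ)
    _ = 40 / (3 * (1 - θ₀)) * A * (M : ℝ) ^ (1 - θ) := by rw [← div_div]; ring

end Summit.CriticalPhenomena.PercolationContinuityZ3.Theorems

end
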